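import Mathlib
import HarnessLib
import Summits.ValiantsHypothesis.ValiantsHypothesis.Theorems.MonotoneRestorationOrbitRestorationQPNarrowSpanNewton

/-!
# Column-separable invariants `Π_q S(x_{·q})` (`S` symmetric) lie in the treewidth-`≤ 2` span — the UNTWISTED
# column-local case of A_∞ in SPAN currency, proved end to end

Route MonotoneRestoration, crux `OrbitRestorationQP` (stmt-ValiantsHypothesis-18293), SPAN-currency lane of the open
sub-rung A_∞ (`stub_sigmaPiSigmaValue`); evidence note `SPAN-CURRENCY-A1-g7g4.md` §2.  Helper (`--supports`), def-free.

For a SYMMETRIC polynomial `S ∈ ℂ[y_1, …, y_n]^{Sym_n}` put `S(col q) := S(x_{0q}, …, x_{n-1,q})`.  The product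
`Π_{q<n} S(col q)` is matrix-symmetric (row permutations fix each factor, column permutations permute them) — the
untwisted sibling of the column-Vandermonde product of `…ColumnVandermondesInstance.lean`; e.g. the matrix-symmetric
`ΠΣ` families `Π_q Π_i (a + x_{iq})`, `Π_q Π_{i ≠ i'} (x_{iq} − x_{i'q})` (column discriminants).

* `symmetric_mem_adjoin_psum`, `exists_aeval_psum_eq` — a symmetric polynomial is a polynomial in the power sums
  (Mathlib's fundamental theorem `esymmAlgHom_surjective` + Newton `ReynoldsDescentFalse.esymm_mem_adjoin_psum`);
* `exists_biColumn_polynomial` — hence `S(col q)` is the bi-column evaluation `z_{cd} ↦ Σ_i x_{iq}^c x_{iq'}^d` of a FIXED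
  polynomial (in the variables `z_{c0}`), for every `q'`;
* **`prod_colEval_symmetric_mem_narrowSpan_two`** — `Π_q S(col q) ∈ span_ℂ {hom_{F,n} : tw F ≤ 2}` for every `n` and
  every symmetric `S`: Newton in span currency (`NarrowSpanNewton.prod_mem_narrowSpan_of_psum_mem`) over the power sums
  `Σ_q S(col q)^m = n⁻¹ Σ_{q,q'} (…)`, which are bi-column generators (`ColumnVandermondesNarrow.sum_sum_aeval_mem`).

Honest label: a column-local class, not the stub; VP ≠ VNP untouched.
-/

noncomputable section

-- `Summit.ValiantsHypothesis.ValiantsHypothesis.…` is the tree's single-conjunct layout (Sub = Summit).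
set_option linter.dupNamespace false

namespace Summit.ValiantsHypothesis.ValiantsHypothesis.Theorems

namespace SeparableColumns

open MvPolynomial Finset
open Literature.Computability.AlgebraicComplexity (homPoly)
open Literature.Combinatorics.SimpleGraph (treewidth)

/-- **A symmetric polynomial is a polynomial in the power sums** (characteristic `0`). [cite: Macdonald1995, I (2.12)] -/
theorem symmetric_mem_adjoin_psum (n : ℕ) (S : MvPolynomial (Fin n) ℂ) (hS : S.IsSymmetric) :
    S ∈ Algebra.adjoin ℂ (Set.range (MvPolynomial.psum (Fin n) ℂ)) := by
  obtain ⟨G, hG⟩ := esymmAlgHom_surjective ℂ (σ := Fin n) (n := n) (by simp) ⟨S, (mem_symmetricSubalgebra S).2 hS⟩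
  have hS' : S = aeval (fun i : Fin n => esymm (Fin n) ℂ (i + 1)) G := by
    have := congrArg Subtype.val hG
    rw [esymmAlgHom_apply] at this
    exact this.symm
  rw [hS']
  have hmem : aeval (fun i : Fin n => esymm (Fin n) ℂ (i + 1)) G ∈
      Algebra.adjoin ℂ (Set.range fun i : Fin n => esymm (Fin n) ℂ (i + 1)) := by
    rw [Algebra.adjoin_range_eq_range_aeval]
    exact ⟨G, rfl⟩
  refine Algebra.adjoin_le ?_ hmem
  rintro _ ⟨i, rfl⟩
  exact ReynoldsDescentFalse.esymm_mem_adjoin_psum (Fin n) (i + 1)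

/-- A symmetric polynomial is `G(p_0, p_1, p_2, …)` for some polynomial `G` in variables indexed by `ℕ`.
[cite: Macdonald1995, I (2.12)] -/
theorem exists_aeval_psum_eq (n : ℕ) (S : MvPolynomial (Fin n) ℂ) (hS : S.IsSymmetric) :
    ∃ G : MvPolynomial ℕ ℂ, S = aeval (MvPolynomial.psum (Fin n) ℂ) G := by
  have h := symmetric_mem_adjoin_psum n S hS
  rw [Algebra.adjoin_range_eq_range_aeval] at h
  obtain ⟨G, hG⟩ := h
  exact ⟨G, hG.symm⟩

/-- **`S(col q)` is the bi-column evaluation of a fixed polynomial**, for every second column `q'`. [folklore] -/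
theorem exists_biColumn_polynomial (n : ℕ) (S : MvPolynomial (Fin n) ℂ) (hS : S.IsSymmetric) :
    ∃ F : MvPolynomial (ℕ × ℕ) ℂ, ∀ q q' : Fin n,
      aeval (fun i : Fin n => (X (i, q) : MvPolynomial (Fin n × Fin n) ℂ)) S =
        aeval (fun cd : ℕ × ℕ => ∑ i : Fin n,
          (X (i, q) : MvPolynomial (Fin n × Fin n) ℂ) ^ cd.1 * X (i, q') ^ cd.2) F := by
  obtain ⟨G, hG⟩ := exists_aeval_psum_eq n S hS
  refine ⟨rename (fun m : ℕ => (m, 0)) G, fun q q' => ?_⟩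
  rw [hG, aeval_rename, ← AlgHom.comp_apply, MvPolynomial.comp_aeval]
  refine congrArg (fun f : ℕ → MvPolynomial (Fin n × Fin n) ℂ => aeval f G) (funext fun m => ?_)
  simp [MvPolynomial.psum]

/-- **Column-separable symmetric products lie in the treewidth-`≤ 2` span.**  For every `n` and every symmetric
`S ∈ ℂ[y]^{Sym_n}`, `Π_{q<n} S(col q) ∈ span_ℂ {hom_{F,n} : tw F ≤ 2}`. [folklore; cite: DwivediPagoSeppelt2026, §8] -/
theorem prod_colEval_symmetric_mem_narrowSpan_two (n : ℕ) (S : MvPolynomial (Fin n) ℂ) (hS : S.IsSymmetric) :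
    (∏ q : Fin n, aeval (fun i : Fin n => (X (i, q) : MvPolynomial (Fin n × Fin n) ℂ)) S) ∈
      Submodule.span ℂ {p : MvPolynomial (Fin n × Fin n) ℂ |
        ∃ (a b : ℕ) (E : Multiset (Fin a × Fin b)),
          treewidth (SimpleGraph.fromRel fun u v : Fin a ⊕ Fin b =>
            ∃ e ∈ E, u = Sum.inl e.1 ∧ v = Sum.inr e.2) ≤ 2 ∧ p = homPoly E n ℂ} := by
  rcases Nat.eq_zero_or_pos n with rfl | hn
  · -- no columns: the empty product is `1`, a narrow generator
    rw [Finset.univ_eq_empty, Finset.prod_empty]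
    exact Submodule.subset_span ⟨0, 0, 0,
      by rw [NarrowSpanAlgebra.treewidth_patternGraph_empty]; exact Nat.zero_le _,
      (NarrowSpanAlgebra.homPoly_empty_eq_one 0).symm⟩
  refine NarrowSpanNewton.prod_mem_narrowSpan_of_psum_mem n 2 _ fun m => ?_
  -- the power sum `Σ_q S(col q)^m = n⁻¹ · Σ_{q,q'} F_m(p(q,q'))`
  have hSm : (S ^ m).IsSymmetric :=
    (mem_symmetricSubalgebra _).1 (Subalgebra.pow_mem _ ((mem_symmetricSubalgebra S).2 hS) m)
  obtain ⟨F, hF⟩ := exists_biColumn_polynomial n (S ^ m) hSm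
  have hsum : (∑ q : Fin n, (aeval (fun i : Fin n => (X (i, q) : MvPolynomial (Fin n × Fin n) ℂ)) S) ^ m) =
      ((n : ℕ) : ℂ)⁻¹ • ∑ q : Fin n, ∑ q' : Fin n,
        aeval (fun cd : ℕ × ℕ => ∑ i : Fin n,
          (X (i, q) : MvPolynomial (Fin n × Fin n) ℂ) ^ cd.1 * X (i, q') ^ cd.2) F := by
    have h1 : ∀ q : Fin n, (aeval (fun i : Fin n => (X (i, q) : MvPolynomial (Fin n × Fin n) ℂ)) S) ^ m =
        ((n : ℕ) : ℂ)⁻¹ • ∑ q' : Fin n, aeval (fun cd : ℕ × ℕ => ∑ i : Fin n,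
          (X (i, q) : MvPolynomial (Fin n × Fin n) ℂ) ^ cd.1 * X (i, q') ^ cd.2) F := by
      intro q
      have hc : ∀ q' : Fin n, aeval (fun cd : ℕ × ℕ => ∑ i : Fin n,
          (X (i, q) : MvPolynomial (Fin n × Fin n) ℂ) ^ cd.1 * X (i, q') ^ cd.2) F =
          (aeval (fun i : Fin n => (X (i, q) : MvPolynomial (Fin n × Fin n) ℂ)) S) ^ m := by
        intro q'
        rw [← map_pow, hF q q']
      simp_rw [hc]
      rw [Finset.sum_const, Finset.card_univ, Fintype.card_fin, ← Nat.cast_smul_eq_nsmul ℂ,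
        inv_smul_smul₀ (by exact_mod_cast hn.ne')]
    simp_rw [h1]
    rw [← Finset.smul_sum]
  rw [hsum]
  refine Submodule.smul_mem _ _ (NarrowSpanAlgebra.mem_narrowSpan_of_mem_adjoin n 2 ?_)
  refine ColumnVandermondesNarrow.sum_sum_aeval_mem n _ (fun N f => ?_) F
  refine Algebra.subset_adjoin ⟨N, 2, _, ColumnVandermondesNarrow.treewidth_biColumnPattern_le_two N f, ?_⟩
  rw [ColumnVandermondesNarrow.homPoly_biColumnPattern]

/-- **Matrix symmetry of the column-separable products**: for symmetric `S`, the family `n ↦ Π_q S_n(col q)` (one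
symmetric `S_n` per level) is invariant under independent row and column permutations. [folklore] -/
theorem rename_prod_colEval_symmetric (n : ℕ) (S : MvPolynomial (Fin n) ℂ) (hS : S.IsSymmetric)
    (σ τ : Equiv.Perm (Fin n)) :
    rename (fun p : Fin n × Fin n => (σ p.1, τ p.2))
        (∏ q : Fin n, aeval (fun i : Fin n => (X (i, q) : MvPolynomial (Fin n × Fin n) ℂ)) S) =
      ∏ q : Fin n, aeval (fun i : Fin n => (X (i, q) : MvPolynomial (Fin n × Fin n) ℂ)) S := by
  rw [map_prod]
  have hq : ∀ q : Fin n, rename (fun p : Fin n × Fin n => (σ p.1, τ p.2))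
      (aeval (fun i : Fin n => (X (i, q) : MvPolynomial (Fin n × Fin n) ℂ)) S) =
      aeval (fun i : Fin n => (X (i, τ q) : MvPolynomial (Fin n × Fin n) ℂ)) S := by
    intro q
    rw [← AlgHom.comp_apply, MvPolynomial.comp_aeval]
    have h1 : (aeval fun i : Fin n => (rename fun p : Fin n × Fin n => (σ p.1, τ p.2))
        (X (i, q) : MvPolynomial (Fin n × Fin n) ℂ)) S =
        aeval (fun i : Fin n => (X (i, τ q) : MvPolynomial (Fin n × Fin n) ℂ)) (rename σ S) := by
      rw [aeval_rename]
      exact congrArg (fun f : Fin n → MvPolynomial (Fin n × Fin n) ℂ => aeval f S)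
        (funext fun i => by simp)
    rw [h1, hS σ]
  simp_rw [hq]
  exact Equiv.prod_comp τ (fun q : Fin n => aeval (fun i : Fin n => (X (i, q) : MvPolynomial (Fin n × Fin n) ℂ)) S)

end SeparableColumns

end Summit.ValiantsHypothesis.ValiantsHypothesis.Theorems

end
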